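import Summits.BirchSwinnertonDyer.BirchSwinnertonDyer.Theorems.ByReductionTypeAtTwoMultLowerHalfInputsOdd
import Literature.NumberTheory.EllipticCurves.Greenberg1999.SelmerCotorsionMultiplicative
import HarnessLib

/-!
# Route `ByReductionTypeAtTwo`, layer-2 child `MultLowerHalfAtTwo` (item stmt-BirchSwinnertonDyer-19923):
# the integral road to the LOWER half WITHOUT the memo binder K11 — «`X(E/ℚ_∞)` is `Λ`-torsion at a
# multiplicative `2`» is PRINT (Greenberg 1999, Thm. 1.5, Kato–Rohrlich)

Cell `bsd-2adic`, seat `bsd-2adic-conv-2` GEN 4 (filed for the mult-3 lane, announced on the cell bus;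
one-line composition, no new object). THEOREMS ONLY — nothing asserted, no definition; the one new PRINT
input is the Literature named fact `Greenberg1999.thm15_isTorsion_multiplicative_rat` (file
`Literature/NumberTheory/EllipticCurves/Greenberg1999/SelmerCotorsionMultiplicative.lean`).

WHAT THIS FILE DOES. The twin bridge `multLowerHalfAtTwo_of_multEisenstein'` (p428384, seat mult-3 GEN 3)
reads the route's child `MultLowerHalfAtTwo` (item 19923) from PRINT {A235-twin `h41ns`, A236 `h41sp`,
modularity, GZK} + MEMO {K11 `hKato` = `X5.O1.KatoMultiplicativeDivisibilityRat W 2`, Greenberg–Stevens at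
`2` `hGS`} + the ONE research object T-mult-4-int; and it uses K11 ONLY through its clause (1) «`X(E/ℚ_∞)`
is `Λ`-torsion» (`(hKato …).1` inside `missingLowerBoundAt_two_of_multEisenstein_of_greenberg'_of_multRat`).
That clause is Greenberg's Thm. 1.5 (LNM 1716 p. 61, Kato–Rohrlich; no parity binder; multiplicative
reduction included), now a Literature named fact. Hence:
* `missingLowerBoundAt_two_of_multEisenstein_of_greenberg'_of_thm15` — per pair, K11-free;
* `multLowerHalfAtTwo_of_multEisenstein_of_cotorsion` — **the route decl `MultLowerHalfAtTwo` (19923) from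
  PRINT {A235-twin, A236, modularity, GZK, Thm. 1.5} + MEMO {Greenberg–Stevens at `2`, split case} + ∀
  T-mult-4-int** — the only memo binder left on the lower-half road is GS at a split `2`.
What this is NOT: a proof of 19923 (T-mult-4-int at `2` is open); not a discharge of K11's divisibility
clause (2), which the UPPER half (19922) and every BSD₂ door genuinely use; BSD is not proved by any of this.
PARTITION (D-0054): X5@2 mult (K4ᵐ, RESIDUAL-MAP B1·O1; 1 976 book230 classes) × p = 2 —
types-the-object-of (item 19923: memo-binder hygiene); closes none; nothing booked.
[cite: GreenbergLNM1716, Thm. 1.5 (p. 61), §4 pp. 112–113 and §3] [cite: Miller2011LMS, Def 1.1]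
-/

set_option autoImplicit false
set_option linter.dupNamespace false

noncomputable section

open scoped Classical MatrixGroups ModularForm

open CongruenceSubgroup WeierstrassCurve Literature.NumberTheory.EllipticCurves
  Literature.NumberTheory.EllipticCurves.ModularForms
  Literature.NumberTheory.EllipticCurves.Greenberg1999
  Literature.NumberTheory.EllipticCurves.Rank1Residual
  Literature.NumberTheory.EllipticCurves.Rank1Residual.Typed
  Summit.BirchSwinnertonDyer.Rank1Residual.X5

namespace Summit.BirchSwinnertonDyer.BirchSwinnertonDyer.Theorems

/-- **The per-pair LOWER half on «r_an = 0, Mult@2» from PRINT + GS-at-split-`2` + T-mult-4-int, K11-FREE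
(PROVED).** As `missingLowerBoundAt_two_of_multEisenstein_of_greenberg'_of_multRat` (p428384) with the
torsion binder supplied by Greenberg's Thm. 1.5 (`h15`, PRINT, read at the newform of `E` given by
modularity) instead of clause (1) of K11: the guarded non-split display (`h41ns`), the split display A236
(`h41sp`), modularity, GZK, Greenberg–Stevens at a split `2` (`hGS`) and `O1.MultEisensteinDivisibilityAtTwo W`
(T-mult-4-int) give `MissingLowerBoundAt W 2` for `E/ℚ` multiplicative at `2` of analytic rank `0`.
[cite: GreenbergLNM1716, Thm. 1.5 (p. 61) and §4 pp. 112–113] [cite: Miller2011LMS, Def. 1.1 and §1] -/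
theorem missingLowerBoundAt_two_of_multEisenstein_of_greenberg'_of_thm15
    (W : WeierstrassCurve ℚ) [W.IsElliptic] [W.IsGloballyMinimal]
    (h41ns : thm41Analogue_charValue_rankZero_numberField_anyPrime_oddLocalDegree)
    (h41sp : thm41Analogue_charValue_rankZero_split_baseChange_anyPrime)
    (hmod : nonempty_modularParametrizationData)
    (hGZK : rank_eq_analyticRank_of_analyticRank_le_one)
    (h15 : thm15_isTorsion_multiplicative_rat)
    (hGS : W.HasSplitMultiplicativeReductionAtPrime 2 → greenberg_stevens (W := W) (p := 2))
    (hr : W.analyticRank = 0) (hmult : Mult W 2) (h : O1.MultEisensteinDivisibilityAtTwo W) :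
    MissingLowerBoundAt W 2 := by
  haveI : NeZero (W.conductorNorm ℤ) := ⟨(W.conductorNorm_pos_holds).ne'⟩
  obtain ⟨Dm⟩ := hmod W
  exact O1.missingLowerBoundAt_two_of_multEisenstein W
    (O1.twoAdicEulerCharRankZeroNonsplitMult_zero_of_greenberg' W h41ns)
    (O1.twoAdicEulerCharRankZeroSplitMult_zero_of_greenberg W h41sp) hmod hGZK
    (fun κ γ hκ hγ _ D => h15 W 2 hmult Dm.f Dm.isNewformOf κ γ hκ hγ D) hGS hr hmult h

/-- **Bridge (T-mult-4-int ⇒ the lower half, item 19923), K11-FREE.** PRINT {the guarded Thm-4.1 analogue at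
a non-split multiplicative prime (`h41ns`), A236 (`h41sp`), modularity (`hmod`), GZK (`hGZK`), Greenberg's
Thm. 1.5 (Kato–Rohrlich) `h15`} + MEMO {Greenberg–Stevens at a split `2` (`hGS`)} + the ONE research object
T-mult-4-int ∀-closed over non-CM `E/ℚ` of analytic rank `0` multiplicative at `2` (`hE`) imply the route's
child `MultLowerHalfAtTwo`. Same composition as `multLowerHalfAtTwo_of_multEisenstein'` (p428384) with the
per-pair theorem above; no use of Kato's `⊗ℚ` divisibility remains. Composition certificate; nothing
asserted; the item stays OPEN with T-mult-4-int. [cite: GreenbergLNM1716, Thm. 1.5 (p. 61), §4 pp. 112–113 and §3]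
[cite: Miller2011LMS, Def 1.1] -/
theorem multLowerHalfAtTwo_of_multEisenstein_of_cotorsion
    (h41ns : thm41Analogue_charValue_rankZero_numberField_anyPrime_oddLocalDegree)
    (h41sp : thm41Analogue_charValue_rankZero_split_baseChange_anyPrime)
    (hmod : nonempty_modularParametrizationData)
    (hGZK : rank_eq_analyticRank_of_analyticRank_le_one)
    (h15 : thm15_isTorsion_multiplicative_rat)
    (hGS : ∀ (W : WeierstrassCurve ℚ) [W.IsElliptic] [W.IsGloballyMinimal],
      W.HasSplitMultiplicativeReductionAtPrime 2 → greenberg_stevens (W := W) (p := 2))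
    (hE : ∀ (W : WeierstrassCurve ℚ) [W.IsElliptic] [W.IsGloballyMinimal],
      ¬ W.HasCM → W.analyticRank = 0 → Mult W 2 → O1.MultEisensteinDivisibilityAtTwo W) :
    Summit.BirchSwinnertonDyer.BirchSwinnertonDyer.Theses.ByReductionTypeAtTwo.MultLowerHalfAtTwo := by
  unfold Summit.BirchSwinnertonDyer.BirchSwinnertonDyer.Theses.ByReductionTypeAtTwo.MultLowerHalfAtTwo
  intro W _ _ hcm hr hmult
  exact missingLowerBoundAt_two_of_multEisenstein_of_greenberg'_of_thm15 W h41ns h41sp hmod hGZK h15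
    (hGS W) hr hmult (hE W hcm hr hmult)

end Summit.BirchSwinnertonDyer.BirchSwinnertonDyer.Theorems

end
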